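import Literature.AlgebraicTopology.SingularHomology.HurewiczTheorem
import Literature.AlgebraicTopology.SingularHomology.HurewiczCompression
import Literature.AlgebraicTopology.SingularHomology.HurewiczEilenberg
import HarnessLib

/-!
# Proofs of the Hurewicz theorem (`hurewicz_isZero`, `hurewicz_iso`)

Topic `Literature/AlgebraicTopology/SingularHomology`, sibling of `HurewiczTheorem.lean`, which
vendors A. Hatcher, *Algebraic Topology*, CUP 2002, **Theorem 4.32** (held copy PDF p. 476,
printed p. 366: "If a space `X` is `(n-1)`-connected, `n ≥ 2`, then `H̃ᵢ(X) = 0` for `i < n` and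
`πₙ(X) ≈ Hₙ(X)`") as the named facts `hurewicz_isZero` (vanishing clause) and `hurewicz_iso`.
Both clauses are DISCHARGED:

* `Literature.AlgebraicTopology.SingularHomology.hurewicz_isZero_holds : hurewicz_isZero`, proved
  in this file;
* the isomorphism clause `πₙ(X) ≅ Hₙ(X; ℤ)` is the theorem
  `Literature.AlgebraicTopology.SingularHomology.hurewicz_iso_of_collapseDevice : hurewicz_iso` of
  `HurewiczEilenberg.lean` — E. H. Spanier's Eilenberg-subcomplex proof (*Algebraic Topology* (1981),
  Ch. 7 §4 Thm. 8 / Cor. 9 and §5 (d)–(e), Thm. 7.5.5): the inclusion `Δ(X, {x}, x)ⁿ⁻¹ ⊂ Δ(X)` is a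
  quasi-isomorphism for `(n-1)`-connected `X` (`EilenbergDeformationChains.lean`), and
  `Hₙ(Δ(X, {x}, x)ⁿ⁻¹) ≅ πₙ(X, x)` through Spanier's `ψ′` (`HurewiczDevice.lean`) for the device
  `g ↦ [g ∘ κₙ]` whose homotopy addition nullity is the cubical homotopy addition theorem
  (`HomotopyAdditionProofs.lean`, `Homotopy/CubicalHomotopyAddition.lean`). USE THAT NAME to feed a
  hypothesis `(h : hurewicz_iso)`. The conventional discharge name `hurewicz_iso_holds` (D-0014,
  `<fact>_holds`) is kept below only as a deprecated one-line alias of it (dedup-00034): it is not a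
  second proof, and nothing in the tree refers to it.

The rest of this header concerns the vanishing clause.

The proof is not Hatcher's printed one (CW approximation, Prop. 4.13–4.15, plus cellular
homology; likewise Fomenko–Fuchs 2016, §14.2) but the classical chain-level compression argument
of S. Eilenberg (Singular homology theory, Ann. of Math. 45 (1944)) as in E. Spanier, *Algebraic
Topology* (1966), Ch. 7, Sec. 4, carried out in `HurewiczCompression.lean`
(`isZero_singularHomology_of_cubesContractUpTo`: if all maps `(I^q, ∂I^q) → (X, x₀)`, `q ≤ m`,
are null-homotopic rel `∂I^q`, then `Hₘ(X; R) = 0`), on top of the universal prism chains of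
`PrismChains.lean` and the box filling over simplices of `SimplexBoxExtension.lean`. Here we only
translate the hypotheses of Thm. 4.32 — `X` simply connected (Mathlib's `SimplyConnectedSpace`)
with `π_k(X, x) = 0` for `2 ≤ k < n` in Mathlib's cubical model `π_ k X x = HomotopyGroup (Fin k) X x`
— into that cube-contraction hypothesis (`cubesContractUpTo_of_subsingleton_homotopyGroup`, as in
`WhiteheadCW.cubesContract_of_subsingleton_homotopyGroup`) and apply it in each degree
`0 < i < n`.

## References

* A. Hatcher, *Algebraic Topology*, CUP 2002, §4.2, Thm. 4.32 (p. 366). [HatcherAT2002]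
* E. H. Spanier, *Algebraic Topology*, Springer 1981 (reprint of the 1966 edition), Ch. 7, Sec. 4–5
  (the Hurewicz theorem via the Eilenberg subcomplex). [Spanier1981]
-/

noncomputable section

open CategoryTheory Limits
open scoped _root_.Topology _root_.Topology.Homotopy

universe u

namespace Literature.AlgebraicTopology.SingularHomology

open unitInterval in
/-- **From homotopy groups to contracting cubes**: in a simply connected space with
`π_k(X, x₀) = 0` for `2 ≤ k ≤ m`, every map `(I^q, ∂I^q) → (X, x₀)`, `q ≤ m`, is null-homotopic
rel `∂I^q` (for `q = 0`: a path to `x₀`; for `q = 1`: `π₁ ≃ FundamentalGroup` is trivial; for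
`q ≥ 2`: the hypothesis, unfolded through Mathlib's definition of `HomotopyGroup` as a quotient of
`GenLoop`). [folklore] -/
theorem cubesContractUpTo_of_subsingleton_homotopyGroup {X : Type u} [TopologicalSpace X]
    [SimplyConnectedSpace X] (x₀ : X) (m : ℕ)
    (hπ : ∀ k : ℕ, 2 ≤ k → k ≤ m → Subsingleton (π_ k X x₀)) :
    Compression.CubesContractUpTo x₀ m := by
  intro q hq ψ hψ
  rcases Nat.eq_zero_or_pos q with rfl | hq0
  · -- a map from the point `I^0`: join its value to `x₀`
    let y₀ : Fin 0 → I := fun i => i.elim0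
    let γ : Path (ψ y₀) x₀ := PathConnectedSpace.somePath _ _
    refine ⟨⟨⟨fun p => γ p.1, γ.continuous.comp continuous_fst⟩, fun y => ?_, fun y => ?_⟩, ?_⟩
    · change γ 0 = ψ y
      rw [Subsingleton.elim y y₀]; exact γ.source
    · exact γ.target
    · rintro t y ⟨i, -⟩; exact i.elim0
  · haveI : Subsingleton (π_ q X x₀) := by
      rcases (show q = 1 ∨ 2 ≤ q by omega) with rfl | h2
      · exact (HomotopyGroup.pi1EquivFundamentalGroup : π_ 1 X x₀ ≃ FundamentalGroup X x₀).subsingleton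
      · exact hπ q h2 hq
    have h : GenLoop.Homotopic (⟨ψ, hψ⟩ : Ω^ (Fin q) X x₀) GenLoop.const :=
      Quotient.exact (Subsingleton.elim (α := HomotopyGroup (Fin q) X x₀) _ _)
    exact h

/-- **The vanishing clause of the Hurewicz theorem** (Hatcher, *Algebraic Topology* (2002),
Thm. 4.32, first clause of the absolute case, as vendored in `hurewicz_isZero`): for `n ≥ 2` and
`X` `(n-1)`-connected — simply connected with `π_k(X, x) = 0` for all `2 ≤ k < n` and all `x` —
the singular homology `Hᵢ(X; ℤ)` vanishes for `0 < i < n`. PROVED (discharge of the named fact),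
by the Eilenberg–Spanier compression of singular simplices
(`isZero_singularHomology_of_cubesContractUpTo`) applied in degree `i` with the cube-contraction
hypothesis up to dimension `i ≤ n - 1`. [cite: HatcherAT2002, Thm. 4.32] -/
theorem hurewicz_isZero_holds : hurewicz_isZero.{u} := by
  intro X _ _ n hn hπ i hi hin
  obtain ⟨x₀⟩ := (inferInstance : Nonempty X)
  obtain ⟨m, rfl⟩ := Nat.exists_eq_succ_of_ne_zero hi.ne'
  have hc : Compression.CubesContractUpTo x₀ (m + 1) :=
    cubesContractUpTo_of_subsingleton_homotopyGroup x₀ (m + 1) fun k hk hkm => hπ k hk (by omega) x₀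
  exact isZero_singularHomology_of_cubesContractUpTo hc ℤ

/-- Deprecated alias — use `hurewicz_iso_of_collapseDevice` (`HurewiczEilenberg.lean`), which IS
the proof of the named fact `hurewicz_iso` (Hatcher Thm. 4.32, isomorphism clause); this is only its
conventional D-0014 discharge name `<fact>_holds`. [cite: HatcherAT2002, Thm. 4.32] -/
@[deprecated hurewicz_iso_of_collapseDevice (since := "2026-08-15")]
theorem hurewicz_iso_holds : hurewicz_iso.{u} :=
  hurewicz_iso_of_collapseDevice

end Literature.AlgebraicTopology.SingularHomology
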